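import Mathlib
import Literature.Probability.LatticeModels.RandomCurrents
import Literature.Probability.LatticeModels.IsingModel
import Literature.Probability.Percolation.ConstrainedClusters
import HarnessLib

/-!
# Sketch — crux `IsingEuclidUpgradeR4NonGaussian` (item stmt-CriticalPhenomena-0636), ideator 2, round 1

First lemmas of the idea cards in `Ideas/`.  Nothing here is proved; every `def … : Prop` is a
statement over existing declarations that must elaborate.

* `NestedSwitching` — Aizenman–Duminil-Copin–Sidoravicius 2015, Lemma 2.2 (switching lemma for a
  nested pair of graphs `H ≤ G` on one vertex set; the sourced current lives on the SMALL graph `H`,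
  the connection is read inside `H`), written, like the tree's `currentSum_switching`, as an identity of
  `tsum`s of pair weights, for functions of the combined trace.
* `CutOnePointIdentity` — its `F = 1` corollary, the engine of card `backbone-cut-switching`:
  `Z^∅_H · Z^{xy}_G · P^{∅}_H ⊗ P^{xy}_G [x ↔ u inside H] = Z^{xu}_H · Z^{yu}_G`, i.e. the cluster of `x`
  in (sourced current on `G`) + (sourceless current on the cut graph `H`) has the EXACT one-point
  function `⟨σ_x σ_u⟩_H ⟨σ_u σ_y⟩_G / ⟨σ_x σ_y⟩_G` (`CutOnePointDensity`).
-/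

noncomputable section

open MeasureTheory Finset
open scoped symmDiff

namespace Summit.CriticalPhenomena.Ising3DConformalLimit.Cruxes.IsingEuclidUpgradeR4NonGaussian.Sketch

open Literature.Probability Literature.Probability.LatticeModels

variable (V : Type*) [Fintype V] [DecidableEq V]

/-- The pair weight of a (current on `H`, current on `G`) pair with prescribed sources. -/
def cutPairWeight (G H : SimpleGraph V) [DecidableRel G.Adj] [DecidableRel H.Adj] (β : ℝ)
    (A B : Finset V) (p : Current H × Current G) : ℝ :=
  if p.1.sources = A ∧ p.2.sources = B then p.1.weight β * p.2.weight β else 0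

/-- The combined trace `trace(n_H) ∪ trace(n_G)` of such a pair, a bond configuration on `V`. -/
def cutTrace (G H : SimpleGraph V) [DecidableRel G.Adj] [DecidableRel H.Adj]
    (p : Current H × Current G) : Percolation.BondConfig V :=
  p.1.traced ∪ p.2.traced

/-- **ADS 2015, Lemma 2.2 (nested switching), trace form.** For `H ≤ G`, `β ≥ 0`, `A ⊆ V`, vertices
`x u` and a bounded function `F` of the combined trace:
`∑_{∂n₁ = {x}Δ{u} on H, ∂n₂ = A on G} w w F = ∑_{∂n₁ = ∅ on H, ∂n₂ = A Δ {x}Δ{u} on G} w w F · 1[x ↔ u in H]`,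
where "`x ↔ u` in `H`" is read on the combined trace restricted to the edges of `H`
(`Percolation.openConnVia H x u`). -/
def NestedSwitching : Prop :=
  ∀ (G H : SimpleGraph V) [DecidableRel G.Adj] [DecidableRel H.Adj], H ≤ G →
    ∀ (β : ℝ), 0 ≤ β → ∀ (A : Finset V) (x u : V) (F : Percolation.BondConfig V → ℝ),
      (∃ C, ∀ ω, |F ω| ≤ C) →
        ∑' p : Current H × Current G,
            cutPairWeight V G H β ({x} ∆ {u}) A p * F (cutTrace V G H p)
          = ∑' p : Current H × Current G,
            cutPairWeight V G H β ∅ (A ∆ ({x} ∆ {u})) p * F (cutTrace V G H p) *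
              (Percolation.openConnVia H x u).indicator 1 (cutTrace V G H p)

/-- **Cut one-point identity** (`F = 1`, `A = {y} Δ {u}` in `NestedSwitching`):
`∑_{∂n₁ = ∅ on H, ∂n₂ = {x}Δ{y} on G} w w · 1[x ↔ u in H] = Z_H[{x}Δ{u}] · Z_G[{y}Δ{u}]`. -/
def CutOnePointIdentity : Prop :=
  ∀ (G H : SimpleGraph V) [DecidableRel G.Adj] [DecidableRel H.Adj], H ≤ G →
    ∀ (β : ℝ), 0 ≤ β → ∀ (x y u : V),
      ∑' p : Current H × Current G,
          cutPairWeight V G H β ∅ ({x} ∆ {y}) p *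
            (Percolation.openConnVia H x u).indicator 1 (cutTrace V G H p)
        = currentSum H β ({x} ∆ {u}) * currentSum G β ({y} ∆ {u})

/-- **Cut one-point density** (free Ising two-point functions, `β ≥ 0`, non-degenerate current sums):
the probability, under `P^∅_H ⊗ P^{xy}_G`, that `u` lies in the `H`-cluster of `x` equals
`⟨σ_x σ_u⟩^{free}_H · ⟨σ_u σ_y⟩^{free}_G / ⟨σ_x σ_y⟩^{free}_G`. -/
def CutOnePointDensity : Prop :=
  ∀ (G H : SimpleGraph V) [DecidableRel G.Adj] [DecidableRel H.Adj], H ≤ G →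
    ∀ (β : ℝ), 0 ≤ β → ∀ (x y u : V),
      currentSum H β ∅ ≠ 0 → currentSum G β ({x} ∆ {y}) ≠ 0 →
      isingTwoPoint G univ β 0 .free x y ≠ 0 →
        (∑' p : Current H × Current G,
            cutPairWeight V G H β ∅ ({x} ∆ {y}) p *
              (Percolation.openConnVia H x u).indicator 1 (cutTrace V G H p))
          / (currentSum H β ∅ * currentSum G β ({x} ∆ {y}))
        = isingTwoPoint H univ β 0 .free x u * isingTwoPoint G univ β 0 .free u y
            / isingTwoPoint G univ β 0 .free x y

end Summit.CriticalPhenomena.Ising3DConformalLimit.Cruxes.IsingEuclidUpgradeR4NonGaussian.Sketch
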